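import Summits.Ventures.CertifiedManyBodySolver.Downfold.BoxesLa214V115M2bCurtain
import Summits.Ventures.CertifiedManyBodySolver.Downfold.BoxesCuprateEStiffnessKinematic
import Summits.Ventures.CertifiedManyBodySolver.Downfold.BoxesNdNiO2E
import Summits.Ventures.CertifiedManyBodySolver.Observables.StiffnessApexTransportCurtainTargetSlot
import HarnessLib

/-!
# Ventures/CertifiedManyBodySolver — Observables/RungLeavesCoverage.lean

HONEST FRAMING: one-sided certified CEILINGS on the uniform flux stiffness on DOWNFOLDED material boxes (wording class (xx1): CONTROL /
CALIBRATION + labelled heuristic); a ceiling never speaks to the presence of superconductivity; a downfolded box is a systematic modelling claim;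
never «certified true negative / positive»; not a `T_c` or phase-diagram statement. Typing certifies nothing about any material.

Cell `pub/hubbard-downfold` (MO-S2, D-0154 (1)(C) COVERAGE: La214 / Hg-1201 / NdNiO₂), seat hubbard-downfold-unc-2 (`prover-hubbard-downfold-unc-2-g15-0`,
the lineage that typed `Downfold/BoxesLa214V115M2b/M2c`). Written on hubbard-obs RULING (mmm) d309 (2026-08-28T03:28:55Z) item (2) «THE LEAVES (zero-solve
typing, ONE Prop each, the M2(b) OBLIGATION shape of `boxLa214E_M13v115_stiffnessWord_of_cellLeaf`; proposed module `Observables/RungLeavesCoverage.lean`)»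
— the RUNG-class closers the coverage routes «hubbard-cov-la214 / -hg1201 / -ndnio2» register (`ledger route closers`, labels «MOS2-la214-M2b»,
«MOS2-hg1201-M19b»; bars = the PEN's proposal: the D-0150 content bar `0.98 ×` the box's kinematic stiffness word, a director bar replaces them by value):

* `La214M2b_StiffnessBoxCeiling : Prop := ∃ c : ℚ, c ≤ 4364687/10⁷ ∧ HoldsOn (p ↦ ObsStiffnessSeqCeilingAt (p tp) (p U) (p n) c) boxLa214E_M2b`
  («La214-E» `[−3/10, −1/5] × [29/5, 74/5] × n = 1`; bar `0.4364687 = 0.98 × 0.4453763`);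
* `Hg1201M19b_StiffnessBoxCeiling` — the same on `boxHg1201E_M19b` (`[7/2, 44/5] × [−27/50, −43/100] × [167/200, 183/200]`), bar `516680/10⁶ = 0.98 × 0.5272245`
  (kinematic word `boxHg1201E_M19b_stiffness_kinematic`); twin `Hg1201M19_StiffnessBoxCeiling` on `boxHg1201E_M19` (`n ∈ [4/5, 22/25]`), bar `0.5084577`;
* NdNiO₂ `boxNdNiO2E_M21`: the bar `0.98 × κ₂₁` waits for the nickelate kinematic stiffness word (support item S0 of d309; `t′ ∈ [−0.46, −0.36]` is outside
  today's kernel leaf range) — NOT typed here; the parametric shape `StiffnessBoxCeilingBelow B bar` below is what its leaf will instantiate.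

DISCHARGERS (one `exact` each, CONDITIONAL on the families plugged in): from any box leaf of the cell shape (`…_of_cellLeaf`), from the La214-E leaf shape
(`La214M2b_StiffnessBoxCeiling_of_laBoxE_leaf`) — hence from every apex / curtain / target-slot closer of `Downfold/BoxesLa214V115M2b{,Curtain}` — and, for
Hg-1201, from the TARGET-SLOT station at `U_A = 7/2` read with the two END objectives (`Hg1201M19b_StiffnessBoxCeiling_of_apexStation7o2_twoEndObjectives`;
station segment `[−3807/4400, −43/100]`, i.e. overhang to `t′ ≈ −0.865` = `(−27/50)(2 − (7/2)/(44/5))` — the «L» / ladder editions of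
`…CurtainTargetSlot` / `…TargetSlot` §4 shorten it). No number is asserted; no `sorry`; definitions with bodies.

References: D. J. Scalapino, S. R. White, S.-C. Zhang, PRB 47 (1993) 7995, §II [ScalapinoWhiteZhang1993]; T. Hazra, N. Verma, M. Randeria,
PRX 9 (2019) 031049, eqs. (2)–(6) [HazraVermaRanderia2019]; T. Koma, H. Tasaki, J. Stat. Phys. 76 (1994) 745, §1 [KomaTasaki1994].
-/

noncomputable section

namespace Summit.Ventures.CertifiedManyBodySolver.Observables

open Set NonemptyInterval Filter Topology
open Summit.Ventures.CertifiedManyBodySolver.Downfold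
open Summit.Ventures.CertifiedManyBodySolver.Certificates
open Literature.MathematicalPhysics.QuantumLattice Literature.MathematicalPhysics.QuantumLattice.ThermodynamicLimit
open Literature.Probability.LatticeModels
open Matrix HubbardWave0
open scoped BigOperators ComplexOrder

/-! ## §0 The shape: a certified stiffness ceiling BELOW A BAR on a typed one-band box -/

/-- **`StiffnessBoxCeilingBelow B bar`**: some rational `c ≤ bar` is a certified uniform-flux stiffness CEILING at every point `(t′/t, U/t, n)` of the typed
box `B` (`ObsStiffnessSeqCeilingAt`, tree units `t = 1`). The MO-S2 «box ↦ ONE word» obligation shape with a content bar. [cite: ScalapinoWhiteZhang1993, §II] -/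
def StiffnessBoxCeilingBelow (B : OneBandBox) (bar : ℚ) : Prop :=
  ∃ c : ℚ, c ≤ bar ∧ HoldsOn (fun p : OneBandCoord → ℝ => ObsStiffnessSeqCeilingAt (p .tpOverT) (p .UOverT) (p .filling) c) B

/-- A certified box word `c ≤ bar` discharges the shape. -/
theorem stiffnessBoxCeilingBelow_of_holdsOn {B : OneBandBox} {bar c : ℚ} (hc : c ≤ bar)
    (h : HoldsOn (fun p : OneBandCoord → ℝ => ObsStiffnessSeqCeilingAt (p .tpOverT) (p .UOverT) (p .filling) c) B) :
    StiffnessBoxCeilingBelow B bar :=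
  ⟨c, hc, h⟩

/-- Monotone in the bar. -/
theorem StiffnessBoxCeilingBelow.mono {B : OneBandBox} {bar bar' : ℚ} (h : StiffnessBoxCeilingBelow B bar) (hb : bar ≤ bar') :
    StiffnessBoxCeilingBelow B bar' := by
  obtain ⟨c, hc, hW⟩ := h
  exact ⟨c, hc.trans hb, hW⟩

/-! ## §1 La₂CuO₄ parent, «La214-E» (`boxLa214E_M2b`): the M2(b) rung leaf -/

/-- **RUNG LEAF «MOS2-la214-M2b»**: a certified stiffness ceiling `c ≤ 0.4364687` (the D-0150 content bar `= 0.98 × 0.4453763`, the box's kinematic word)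
holds at every point of `boxLa214E_M2b` = `t′/t ∈ [−3/10, −1/5] × U/t ∈ [29/5, 74/5] × n = 1`. CONTROL/CALIBRATION wording class; not a phase sentence.
[cite: ScalapinoWhiteZhang1993, §II] -/
def La214M2b_StiffnessBoxCeiling : Prop :=
  StiffnessBoxCeilingBelow boxLa214E_M2b (4364687 / 10000000)

/-- `La214M2b_StiffnessBoxCeiling` unfolded. -/
theorem La214M2b_StiffnessBoxCeiling_iff :
    La214M2b_StiffnessBoxCeiling ↔ ∃ c : ℚ, c ≤ 4364687 / 10000000 ∧
      HoldsOn (fun p : OneBandCoord → ℝ => ObsStiffnessSeqCeilingAt (p .tpOverT) (p .UOverT) (p .filling) c) boxLa214E_M2b :=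
  Iff.rfl

/-- **Discharger from the La214-E leaf shape**: any `c ≤ 0.4364687` with `∀ tp ∈ [−3/10, −1/5], ∀ U ∈ [29/5, 74/5], ObsStiffnessSeqCeilingAt tp U 1 c` — the
conclusion of EVERY La214-E closer of `Observables/StiffnessApexTransport{LaBoxE,CurtainLaBoxE}` (one station, two bundles, curtains, ladder) — closes the leaf.
[cite: KomaTasaki1994, §1] [cite: ScalapinoWhiteZhang1993, §II] -/
theorem La214M2b_StiffnessBoxCeiling_of_laBoxE_leaf {c : ℚ} (hc : c ≤ 4364687 / 10000000)
    (hW : ∀ tp ∈ Set.Icc (-3 / 10 : ℝ) (-1 / 5), ∀ U ∈ Set.Icc (29 / 5 : ℝ) (74 / 5), ObsStiffnessSeqCeilingAt tp U 1 c) :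
    La214M2b_StiffnessBoxCeiling :=
  stiffnessBoxCeilingBelow_of_holdsOn hc (boxLa214E_M2b_stiffnessWord_of_laBoxE_leaf hW)

/-- **Discharger from a box word** (`HoldsOn … boxLa214E_M2b` with `c ≤ 0.4364687`), e.g. the conclusion of
`boxLa214E_M2b_stiffnessWord_of_apexStation29o5_innerChord_and_cornerObjectiveOverhangChord` (THE TWO D2-A BUNDLES, outer objective `−X₀(−3/10)`).
[cite: ScalapinoWhiteZhang1993, §II] -/
theorem La214M2b_StiffnessBoxCeiling_of_holdsOn {c : ℚ} (hc : c ≤ 4364687 / 10000000)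
    (h : HoldsOn (fun p : OneBandCoord → ℝ => ObsStiffnessSeqCeilingAt (p .tpOverT) (p .UOverT) (p .filling) c) boxLa214E_M2b) :
    La214M2b_StiffnessBoxCeiling :=
  stiffnessBoxCeilingBelow_of_holdsOn hc h

/-- **The leaf from THE TWO D2-A BUNDLES** (inner own-word chord `vI₁, vI₂` on `[−3/10, −1/5] × {29/5}`; outer chord `vO₁, vO₂` on `[−357/740, −3/10] × {29/5}`
for the CONSTANT objective `−X₀(−3/10)`), `c ≥ −vI₁, −vI₂, −vO₁, −vO₂`, `c ≤ 0.4364687`. [cite: KomaTasaki1994, §1] [cite: ScalapinoWhiteZhang1993, §II] -/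
theorem La214M2b_StiffnessBoxCeiling_of_apexStation29o5_twoBundles (vI₁ vI₂ vO₁ vO₂ : ℝ) (c : ℚ) (hbar : c ≤ 4364687 / 10000000)
    (hcI₁ : -vI₁ ≤ ((c : ℚ) : ℝ)) (hcI₂ : -vI₂ ≤ ((c : ℚ) : ℝ)) (hcO₁ : -vO₁ ≤ ((c : ℚ) : ℝ)) (hcO₂ : -vO₂ ≤ ((c : ℚ) : ℝ))
    (hInner : ∀ s ∈ Set.Icc (-3 / 10 : ℝ) (-1 / 5),
      ∀ (ω : InfVolFermionState 2) (Ls : ℕ → ℕ) (ψ : ∀ L, Fock (Orb (FermionTorus 2 L))),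
      Filter.Tendsto Ls Filter.atTop Filter.atTop →
      (∀ j, IsGroundStateInSector (hubbardTorusTT' (Ls j) 1 s (29 / 5)) (rectN 1 (Ls j)) 0 (ψ (Ls j))) →
      (∀ j, star (ψ (Ls j)) ⬝ᵥ ψ (Ls j) = 1) → ω.IsTorusLimitOf ψ Ls →
      (-1 / 5 - s) / (-1 / 5 - -3 / 10) * vI₁ + (s - -3 / 10) / (-1 / 5 - -3 / 10) * vI₂ ≤
        ((Finset.univ : Finset (DihedralGroup 4)).card : ℝ)⁻¹ * ∑ g ∈ (Finset.univ : Finset (DihedralGroup 4)),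
          (ω.expect (d4ShiftSet g 0 (Literature.Probability.LatticeModels.box 2 7))
            (fermionEmbed (PolySite.d4Emb g 0 (Literature.Probability.LatticeModels.box 2 7)) (-oddMomentObsTT s (29 / 5) 0))).re)
    (hOuter : ∀ s ∈ Set.Icc (-(357 / 740) : ℝ) (-3 / 10),
      ∀ (ω : InfVolFermionState 2) (Ls : ℕ → ℕ) (ψ : ∀ L, Fock (Orb (FermionTorus 2 L))),
      Filter.Tendsto Ls Filter.atTop Filter.atTop →
      (∀ j, IsGroundStateInSector (hubbardTorusTT' (Ls j) 1 s (29 / 5)) (rectN 1 (Ls j)) 0 (ψ (Ls j))) →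
      (∀ j, star (ψ (Ls j)) ⬝ᵥ ψ (Ls j) = 1) → ω.IsTorusLimitOf ψ Ls →
      (-3 / 10 - s) / (-3 / 10 - -(357 / 740)) * vO₁ + (s - -(357 / 740)) / (-3 / 10 - -(357 / 740)) * vO₂ ≤
        ((Finset.univ : Finset (DihedralGroup 4)).card : ℝ)⁻¹ * ∑ g ∈ (Finset.univ : Finset (DihedralGroup 4)),
          (ω.expect (d4ShiftSet g 0 (Literature.Probability.LatticeModels.box 2 7))
            (fermionEmbed (PolySite.d4Emb g 0 (Literature.Probability.LatticeModels.box 2 7)) (-oddMomentObsTT (-3 / 10) (29 / 5) 0))).re) :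
    La214M2b_StiffnessBoxCeiling :=
  La214M2b_StiffnessBoxCeiling_of_holdsOn hbar
    (boxLa214E_M2b_stiffnessWord_of_apexStation29o5_innerChord_and_cornerObjectiveOverhangChord vI₁ vI₂ vO₁ vO₂ c hcI₁ hcI₂ hcO₁ hcO₂
      hInner hOuter)

/-! ## §2 HgBa₂CuO₄₊δ «Hg-1201» (`boxHg1201E_M19b` underdoped, `boxHg1201E_M19` optimal): the rung leaves -/

/-- Coordinates of a point of a delivered box `Set.Icc ![a, b, c] ![a', b', c']` (order `(U/t, t′/t, n)`). [folklore] -/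
private theorem mem_s2Box_vec3 {a b c a' b' c' : ℝ} {θ : Fin 3 → ℝ}
    (hθ : θ ∈ Set.Icc (![a, b, c] : Fin 3 → ℝ) ![a', b', c']) :
    (a ≤ θ 0 ∧ θ 0 ≤ a') ∧ (b ≤ θ 1 ∧ θ 1 ≤ b') ∧ (c ≤ θ 2 ∧ θ 2 ≤ c') := by
  rw [Set.mem_Icc, Pi.le_def, Pi.le_def] at hθ
  obtain ⟨hlo, hhi⟩ := hθ
  have h0 := hlo 0; have h1 := hlo 1; have h2 := hlo 2
  have h0' := hhi 0; have h1' := hhi 1; have h2' := hhi 2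
  simp only [Matrix.cons_val_zero, Matrix.cons_val_one, Matrix.head_cons, Matrix.cons_val_two,
    Matrix.tail_cons] at h0 h1 h2 h0' h1' h2'
  exact ⟨⟨h0, h0'⟩, ⟨h1, h1'⟩, ⟨h2, h2'⟩⟩

/-- **RUNG LEAF «MOS2-hg1201-M19b»**: a certified stiffness ceiling `c ≤ 0.5166800` (`= 0.98 × 0.5272245`, the box's kinematic word
`boxHg1201E_M19b_stiffness_kinematic`, rounded down at the 7th decimal) holds at every point of `boxHg1201E_M19b` =
`U/t ∈ [7/2, 44/5] × t′/t ∈ [−27/50, −43/100] × n ∈ [167/200, 183/200]` (HgBa₂CuO₄₊δ underdoped p = 0.125, object E). CONTROL/CALIBRATION wording class;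
not a phase sentence. [cite: ScalapinoWhiteZhang1993, §II] -/
def Hg1201M19b_StiffnessBoxCeiling : Prop :=
  StiffnessBoxCeilingBelow boxHg1201E_M19b (5166800 / 10000000)

/-- **RUNG LEAF (twin) «MOS2-hg1201-M19»**: the same on `boxHg1201E_M19` (optimal p = 0.16, `n ∈ [4/5, 22/25]`) with the bar `0.5084577`
(`= 0.98 × 0.5188344`, `boxHg1201E_M19_stiffness_kinematic`). [cite: ScalapinoWhiteZhang1993, §II] -/
def Hg1201M19_StiffnessBoxCeiling : Prop :=
  StiffnessBoxCeilingBelow boxHg1201E_M19 (5084577 / 10000000)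

/-- **Hg-1201 underdoped: discharger from a CELL leaf** — any `c ≤ 0.5166800` with
`∀ tp ∈ [−27/50, −43/100], ∀ U ∈ [7/2, 44/5], ∀ n ∈ [167/200, 183/200], ObsStiffnessSeqCeilingAt tp U n c` closes the leaf (the shape every 3-D box theorem of
`Observables/StiffnessApexTransport{Doped,CurtainDoped,TargetSlot}` delivers). [cite: ScalapinoWhiteZhang1993, §II] -/
theorem Hg1201M19b_StiffnessBoxCeiling_of_cellLeaf {c : ℚ} (hc : c ≤ 5166800 / 10000000)
    (hW : ∀ tp ∈ Set.Icc (-27 / 50 : ℝ) (-43 / 100), ∀ U ∈ Set.Icc (7 / 2 : ℝ) (44 / 5), ∀ n ∈ Set.Icc (167 / 200 : ℝ) (183 / 200),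
      ObsStiffnessSeqCeilingAt tp U n c) :
    Hg1201M19b_StiffnessBoxCeiling := by
  refine stiffnessBoxCeilingBelow_of_holdsOn hc ?_
  refine holdsOn_of_forall_s2Box (B := boxHg1201E_M19b) (eU := hg1201E_M19b_U) (eS := hg1201E_M19b_tp) (eN := hg1201E_M19b_n)
    rfl rfl rfl (W := fun θ => ObsStiffnessSeqCeilingAt (θ 1) (θ 0) (θ 2) c) ?_
  rw [hg1201E_M19b_s2Lo, hg1201E_M19b_s2Hi]
  intro θ hθ
  obtain ⟨hUθ, htθ, hnθ⟩ := mem_s2Box_vec3 hθ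
  exact hW (θ 1) htθ (θ 0) hUθ (θ 2) hnθ

/-- **Hg-1201 optimal: discharger from a CELL leaf** (`n ∈ [4/5, 22/25]`, bar `0.5084577`). [cite: ScalapinoWhiteZhang1993, §II] -/
theorem Hg1201M19_StiffnessBoxCeiling_of_cellLeaf {c : ℚ} (hc : c ≤ 5084577 / 10000000)
    (hW : ∀ tp ∈ Set.Icc (-27 / 50 : ℝ) (-43 / 100), ∀ U ∈ Set.Icc (7 / 2 : ℝ) (44 / 5), ∀ n ∈ Set.Icc (4 / 5 : ℝ) (22 / 25),
      ObsStiffnessSeqCeilingAt tp U n c) :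
    Hg1201M19_StiffnessBoxCeiling := by
  refine stiffnessBoxCeilingBelow_of_holdsOn hc ?_
  refine holdsOn_of_forall_s2Box (B := boxHg1201E_M19) (eU := hg1201E_M19_U) (eS := hg1201E_M19_tp) (eN := hg1201E_M19_n)
    rfl rfl rfl (W := fun θ => ObsStiffnessSeqCeilingAt (θ 1) (θ 0) (θ 2) c) ?_
  rw [hg1201E_M19_s2Lo, hg1201E_M19_s2Hi]
  intro θ hθ
  obtain ⟨hUθ, htθ, hnθ⟩ := mem_s2Box_vec3 hθ
  exact hW (θ 1) htθ (θ 0) hUθ (θ 2) hnθ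

/-- The Hg-1201 one-station geometry at the low-`U` edge `U_A = 7/2`: station factor `2 − (7/2)/(44/5) = 141/88`, far source of the corner slot
`(−27/50)(141/88) = −3807/4400` (`≈ −0.865`), of the inner slot `(−43/100)(141/88) = −6063/8800`. [folklore] -/
theorem hg1201_M19b_station7o2_geometry :
    (2 : ℝ) - 7 / 2 / (44 / 5) = 141 / 88 ∧ (-27 / 50 : ℝ) * (141 / 88) = -(3807 / 4400) ∧ (-43 / 100 : ℝ) * (141 / 88) = -(6063 / 8800) := by
  refine ⟨?_, ?_, ?_⟩ <;> norm_num

/-- **Hg-1201 underdoped from ONE STATION `U_A = 7/2` read with the TWO END OBJECTIVES (no `K₂` input).** For every density `x ∈ [167/200, 183/200]` two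
unconditional orbit-lower families on the station segment `s ∈ [−3807/4400, −43/100]` (torus-limit ground-state classes at `(s, 7/2, x)`): `vP x s` for the
objective `−X₀(−27/50, 7/2)` and `vQ x s` for `−X₀(−43/100, 7/2)`, with the σ-chord price `−((−43/100 − σ)vP x s + (σ + 27/50)vQ x s)/(11/100) ≤ c` for every
target slot `σ ∈ [−27/50, −43/100]` and source `s ∈ [141σ/88, σ]`, and `c ≤ 0.5166800`: then `Hg1201M19b_StiffnessBoxCeiling`
(`ObsStiffnessSeqCeilingAt_on_box_of_apexStation_twoEndObjectives` per density). The station segment reaches `t′ ≈ −0.865`; the «L» / ladder editions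
(`…CurtainTargetSlot`, `…TargetSlot` §4) trade it for `U`-segment bundles / more stations. [cite: KomaTasaki1994, §1] [cite: ScalapinoWhiteZhang1993, §II] -/
theorem Hg1201M19b_StiffnessBoxCeiling_of_apexStation7o2_twoEndObjectives (vP vQ : ℝ → ℝ → ℝ) (c : ℚ) (hbar : c ≤ 5166800 / 10000000)
    (hP : ∀ x ∈ Set.Icc (167 / 200 : ℝ) (183 / 200), ∀ s ∈ Set.Icc (-(3807 / 4400) : ℝ) (-43 / 100),
      ∀ (ω : InfVolFermionState 2) (Ls : ℕ → ℕ) (ψ : ∀ L, Fock (Orb (FermionTorus 2 L))),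
      Tendsto Ls atTop atTop →
      (∀ j, IsGroundStateInSector (hubbardTorusTT' (Ls j) 1 s (7 / 2)) (rectN x (Ls j)) 0 (ψ (Ls j))) →
      (∀ j, star (ψ (Ls j)) ⬝ᵥ ψ (Ls j) = 1) → ω.IsTorusLimitOf ψ Ls →
      vP x s ≤ ((Finset.univ : Finset (DihedralGroup 4)).card : ℝ)⁻¹ * ∑ g ∈ (Finset.univ : Finset (DihedralGroup 4)),
        (ω.expect (d4ShiftSet g 0 (Literature.Probability.LatticeModels.box 2 7))
          (fermionEmbed (PolySite.d4Emb g 0 (Literature.Probability.LatticeModels.box 2 7)) (-oddMomentObsTT (-27 / 50) (7 / 2) 0))).re)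
    (hQ : ∀ x ∈ Set.Icc (167 / 200 : ℝ) (183 / 200), ∀ s ∈ Set.Icc (-(3807 / 4400) : ℝ) (-43 / 100),
      ∀ (ω : InfVolFermionState 2) (Ls : ℕ → ℕ) (ψ : ∀ L, Fock (Orb (FermionTorus 2 L))),
      Tendsto Ls atTop atTop →
      (∀ j, IsGroundStateInSector (hubbardTorusTT' (Ls j) 1 s (7 / 2)) (rectN x (Ls j)) 0 (ψ (Ls j))) →
      (∀ j, star (ψ (Ls j)) ⬝ᵥ ψ (Ls j) = 1) → ω.IsTorusLimitOf ψ Ls →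
      vQ x s ≤ ((Finset.univ : Finset (DihedralGroup 4)).card : ℝ)⁻¹ * ∑ g ∈ (Finset.univ : Finset (DihedralGroup 4)),
        (ω.expect (d4ShiftSet g 0 (Literature.Probability.LatticeModels.box 2 7))
          (fermionEmbed (PolySite.d4Emb g 0 (Literature.Probability.LatticeModels.box 2 7)) (-oddMomentObsTT (-43 / 100) (7 / 2) 0))).re)
    (hc : ∀ x ∈ Set.Icc (167 / 200 : ℝ) (183 / 200), ∀ σ ∈ Set.Icc (-27 / 50 : ℝ) (-43 / 100), ∀ s ∈ Set.Icc (σ * (141 / 88)) σ,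
      -((-43 / 100 - σ) / (-43 / 100 - -27 / 50) * vP x s + (σ - -27 / 50) / (-43 / 100 - -27 / 50) * vQ x s) ≤ ((c : ℚ) : ℝ)) :
    Hg1201M19b_StiffnessBoxCeiling := by
  obtain ⟨e, eP, -⟩ := hg1201_M19b_station7o2_geometry
  refine Hg1201M19b_StiffnessBoxCeiling_of_cellLeaf hbar fun tp htp U hU n hn => ?_
  exact ObsStiffnessSeqCeilingAt_on_box_of_apexStation_twoEndObjectives (p := -27 / 50) (q := -43 / 100) (UA := 7 / 2) (Umax := 44 / 5)
    (n := n) (by norm_num) (by norm_num) (by norm_num) (by linarith [hn.1]) (by linarith [hn.2]) (vP n) (vQ n) c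
    (fun s hs => hP n hn s (by rwa [e, eP] at hs)) (fun s hs => hQ n hn s (by rwa [e, eP] at hs))
    (fun σ hσ s hs => hc n hn σ hσ s (by rwa [e] at hs)) tp htp U hU

/-! ## (append, same seat) obligation tags: the three leaves are OPEN obligation nodes (rung closers), never vendored facts -/

attribute [conjecture] La214M2b_StiffnessBoxCeiling Hg1201M19b_StiffnessBoxCeiling Hg1201M19_StiffnessBoxCeiling

/-! ## §3 (append, same seat) Hg-1201 WITHOUT the long overhang: the «L» (bottom `U = 7/2` + left edge `t′ = −27/50`) and the LADDER, target-slot, no `K₂` input -/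

/-- **Hg-1201 underdoped from the «L» at any density, lever-free.** For every density `x ∈ [167/200, 183/200]`: a BOTTOM target-slot family `valB x σ s`
(target slots `σ ∈ [−27/50, −43/100]`, sources `s ∈ [−27/50, σ]` on the classes at `(s, 7/2, x)`, objective `−X₀(σ, 7/2)`) and a LEFT-EDGE target-slot family
`valL x σ U'` (`U' ∈ [7/2, 44/5]`, classes at `(−27/50, U', x)`, objective `−X₀(σ, U')`), both with `−val ≤ c`, and `c ≤ 0.5166800` ⇒ `Hg1201M19b_StiffnessBoxCeiling`
(`ObsStiffnessSeqCeilingAt_on_box_of_bottomEdge_and_leftEdge_targetSlot` per density). Every source lies INSIDE the box (no `t′ ≈ −0.865` overhang); the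
left edge is a `U`-segment bundle at `t′ = −27/50`; each vertex read with the two END objectives gives the `σ`-families (`orbitLower_slot_chord_of_two_endObjectives`).
[cite: KomaTasaki1994, §1] [cite: ScalapinoWhiteZhang1993, §II] -/
theorem Hg1201M19b_StiffnessBoxCeiling_of_bottomEdge_and_leftEdge_targetSlot (valB valL : ℝ → ℝ → ℝ → ℝ) (c : ℚ)
    (hbar : c ≤ 5166800 / 10000000)
    (hB : ∀ x ∈ Set.Icc (167 / 200 : ℝ) (183 / 200), ∀ σ ∈ Set.Icc (-27 / 50 : ℝ) (-43 / 100), ∀ s ∈ Set.Icc (-27 / 50 : ℝ) σ,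
      ∀ (ω : InfVolFermionState 2) (Ls : ℕ → ℕ) (ψ : ∀ L, Fock (Orb (FermionTorus 2 L))),
      Tendsto Ls atTop atTop →
      (∀ j, IsGroundStateInSector (hubbardTorusTT' (Ls j) 1 s (7 / 2)) (rectN x (Ls j)) 0 (ψ (Ls j))) →
      (∀ j, star (ψ (Ls j)) ⬝ᵥ ψ (Ls j) = 1) → ω.IsTorusLimitOf ψ Ls →
      valB x σ s ≤ ((Finset.univ : Finset (DihedralGroup 4)).card : ℝ)⁻¹ * ∑ g ∈ (Finset.univ : Finset (DihedralGroup 4)),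
        (ω.expect (d4ShiftSet g 0 (Literature.Probability.LatticeModels.box 2 7))
          (fermionEmbed (PolySite.d4Emb g 0 (Literature.Probability.LatticeModels.box 2 7)) (-oddMomentObsTT σ (7 / 2) 0))).re)
    (hcB : ∀ x ∈ Set.Icc (167 / 200 : ℝ) (183 / 200), ∀ σ ∈ Set.Icc (-27 / 50 : ℝ) (-43 / 100), ∀ s ∈ Set.Icc (-27 / 50 : ℝ) σ,
      -valB x σ s ≤ ((c : ℚ) : ℝ))
    (hL : ∀ x ∈ Set.Icc (167 / 200 : ℝ) (183 / 200), ∀ σ ∈ Set.Icc (-27 / 50 : ℝ) (-43 / 100), ∀ U' ∈ Set.Icc (7 / 2 : ℝ) (44 / 5),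
      ∀ (ω : InfVolFermionState 2) (Ls : ℕ → ℕ) (ψ : ∀ L, Fock (Orb (FermionTorus 2 L))),
      Tendsto Ls atTop atTop →
      (∀ j, IsGroundStateInSector (hubbardTorusTT' (Ls j) 1 (-27 / 50) U') (rectN x (Ls j)) 0 (ψ (Ls j))) →
      (∀ j, star (ψ (Ls j)) ⬝ᵥ ψ (Ls j) = 1) → ω.IsTorusLimitOf ψ Ls →
      valL x σ U' ≤ ((Finset.univ : Finset (DihedralGroup 4)).card : ℝ)⁻¹ * ∑ g ∈ (Finset.univ : Finset (DihedralGroup 4)),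
        (ω.expect (d4ShiftSet g 0 (Literature.Probability.LatticeModels.box 2 7))
          (fermionEmbed (PolySite.d4Emb g 0 (Literature.Probability.LatticeModels.box 2 7)) (-oddMomentObsTT σ U' 0))).re)
    (hcL : ∀ x ∈ Set.Icc (167 / 200 : ℝ) (183 / 200), ∀ σ ∈ Set.Icc (-27 / 50 : ℝ) (-43 / 100), ∀ U' ∈ Set.Icc (7 / 2 : ℝ) (44 / 5),
      -valL x σ U' ≤ ((c : ℚ) : ℝ)) :
    Hg1201M19b_StiffnessBoxCeiling := by
  refine Hg1201M19b_StiffnessBoxCeiling_of_cellLeaf hbar fun tp htp U hU n hn => ?_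
  exact ObsStiffnessSeqCeilingAt_on_box_of_bottomEdge_and_leftEdge_targetSlot (p := -27 / 50) (q := -43 / 100) (UA := 7 / 2)
    (Umax := 44 / 5) (n := n) (by norm_num) (by norm_num) (by norm_num) (by linarith [hn.1]) (by linarith [hn.2]) (valB n) (valL n) c
    (hB n hn) (hcB n hn) (hL n hn) (hcL n hn) tp htp U hU

/-- **Hg-1201 underdoped from a LADDER of target-slot stations** `U : ℕ → ℝ`, `U 0 = 7/2`, `U m = 44/5`, `U k ≤ U (k+1)` (`0 < m`): for every density
`x ∈ [167/200, 183/200]` and station `k < m` a two-parameter family `val x k σ s` (objective `−X₀(σ, U_k)`, `σ ∈ [−27/50, −43/100]`, `s ∈ [σ(2 − U_k/U_{k+1}), σ]` on the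
classes at `(s, U_k, x)`) with `−val ≤ c`, and `c ≤ 0.5166800` ⇒ `Hg1201M19b_StiffnessBoxCeiling` (`ObsStiffnessSeqCeilingAt_on_box_of_apexLadder_targetSlot` per
density): `t′`-bundles only, overhangs as short as the ladder is dense, no `K₂` input. [cite: KomaTasaki1994, §1] [cite: ScalapinoWhiteZhang1993, §II] -/
theorem Hg1201M19b_StiffnessBoxCeiling_of_apexLadder_targetSlot (U : ℕ → ℝ) {m : ℕ} (hm : 0 < m) (hU0 : U 0 = 7 / 2)
    (hUm : U m = 44 / 5) (hmono : ∀ k < m, U k ≤ U (k + 1)) (val : ℝ → ℕ → ℝ → ℝ → ℝ) (c : ℚ) (hbar : c ≤ 5166800 / 10000000)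
    (h : ∀ x ∈ Set.Icc (167 / 200 : ℝ) (183 / 200), ∀ k < m, ∀ σ ∈ Set.Icc (-27 / 50 : ℝ) (-43 / 100),
      ∀ s ∈ Set.Icc (σ * (2 - U k / U (k + 1))) σ,
      ∀ (ω : InfVolFermionState 2) (Ls : ℕ → ℕ) (ψ : ∀ L, Fock (Orb (FermionTorus 2 L))),
      Tendsto Ls atTop atTop →
      (∀ j, IsGroundStateInSector (hubbardTorusTT' (Ls j) 1 s (U k)) (rectN x (Ls j)) 0 (ψ (Ls j))) →
      (∀ j, star (ψ (Ls j)) ⬝ᵥ ψ (Ls j) = 1) → ω.IsTorusLimitOf ψ Ls →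
      val x k σ s ≤ ((Finset.univ : Finset (DihedralGroup 4)).card : ℝ)⁻¹ * ∑ g ∈ (Finset.univ : Finset (DihedralGroup 4)),
        (ω.expect (d4ShiftSet g 0 (Literature.Probability.LatticeModels.box 2 7))
          (fermionEmbed (PolySite.d4Emb g 0 (Literature.Probability.LatticeModels.box 2 7)) (-oddMomentObsTT σ (U k) 0))).re)
    (hc : ∀ x ∈ Set.Icc (167 / 200 : ℝ) (183 / 200), ∀ k < m, ∀ σ ∈ Set.Icc (-27 / 50 : ℝ) (-43 / 100),
      ∀ s ∈ Set.Icc (σ * (2 - U k / U (k + 1))) σ, -val x k σ s ≤ ((c : ℚ) : ℝ)) :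
    Hg1201M19b_StiffnessBoxCeiling := by
  refine Hg1201M19b_StiffnessBoxCeiling_of_cellLeaf hbar fun tp htp u hu n hn => ?_
  have hu' : u ∈ Set.Icc (U 0) (U m) := by rw [hU0, hUm]; exact hu
  exact ObsStiffnessSeqCeilingAt_on_box_of_apexLadder_targetSlot U hm (by rw [hU0]; norm_num) hmono (by norm_num)
    (by linarith [hn.1]) (by linarith [hn.2]) (val n) c (h n hn) (hc n hn) tp htp u hu'

/-! ## §4 (append, seat `hubbard-cov-ndnio2-box-2`) NdNiO₂ «MOS2-ndnio2-M21» (`boxNdNiO2E_M21`) and the Sr-doped twin (`boxNdSrNiO2E_M22`): the rung leaves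

d309's support item S0 («κ₂₁ = the nickelate kinematic stiffness word») is discharged BY CITATION: hubbard-tc p1's kernel leaf
`ndBoxE_parentM21col_stiffnessSeqLeaf` (`Certificates/HubbardSquare_NdM21BoxE_stiffness_kinematic.lean`, in the tree since 2026-08-27) reads
`ObsStiffnessSeqCeilingAt tp U n (4877121/10⁷)` on exactly the `(t′, n)` face `[−23/50, −9/25] × n ≤ 477/500` of `boxNdNiO2E_M21` (typed as the box word
`Downfold.boxNdNiO2E_M21_stiffness_kinematic` in `Downfold/BoxesNdNiO2EStiffnessKinematic.lean`); so **κ₂₁ = 0.4877121** and the PEN's bar is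
`0.98 × 0.4877121 = 0.477957858 ↦ 4779578/10⁷` (rounded DOWN at the 7th decimal, the La214 / Hg-1201 convention). Binding corner:
`(U, t′, n) = (5, −0.46, 0.954)` (kinematic engine preview `0.4809983` there, `0.63 %` above the bar; at the shallow corner `t′ = −0.36` the kernel corner
value `0.4422927` is already below the bar). The M22 twin (Nd₀.₈Sr₀.₂NiO₂, the superconducting film composition, `n ∈ [359/500, 409/500]`): kinematic
word `0.4509038` (kernel leaf `psnoBoxE12_x02_stiffnessSeqLeaf` on the `t′`-superset cell `[−23/50, −7/20]`, `n ≤ 409/500`; box word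
`Downfold.boxNdSrNiO2E_M22_stiffness_kinematic`), bar `0.98 × 0.4509038 ↦ 4418857/10⁷`. Bars are the PEN's proposal; a director bar replaces them by
value — hence the bar-parametric dischargers `stiffnessBoxCeilingBelow_boxNdNiO2E_M21_of_cellLeaf` / `…boxNdSrNiO2E_M22…`. The one-station (`U_A = 5`,
factor `24/17`, far source `−276/425`), «L» and ladder dischargers and the kinematic CONTROLS live in `Observables/RungLeavesCoverageNdNiO2.lean`. -/

/-- **RUNG LEAF «MOS2-ndnio2-M21»**: a certified stiffness ceiling `c ≤ 0.4779578` (`= 0.98 × 0.4877121`, the box's kinematic word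
`boxNdNiO2E_M21_stiffness_kinematic` = κ₂₁, rounded down at the 7th decimal) holds at every point of `boxNdNiO2E_M21` =
`U/t ∈ [5, 17/2] × t′/t ∈ [−23/50, −9/25] × n ∈ [213/250, 477/500]` (infinite-layer NdNiO₂ parent film, object E, words «1BH+3BE»). CONTROL/CALIBRATION
wording class; not a phase sentence. [cite: ScalapinoWhiteZhang1993, §II] -/
def NdNiO2M21_StiffnessBoxCeiling : Prop :=
  StiffnessBoxCeilingBelow boxNdNiO2E_M21 (4779578 / 10000000)

/-- **RUNG LEAF (twin) «MOS2-ndnio2-M22»**: the same on `boxNdSrNiO2E_M22` (Nd₀.₈Sr₀.₂NiO₂, `n ∈ [359/500, 409/500]`) with the bar `0.4418857`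
(`= 0.98 × 0.4509038`, `boxNdSrNiO2E_M22_stiffness_kinematic`). [cite: ScalapinoWhiteZhang1993, §II] -/
def NdNiO2M22_StiffnessBoxCeiling : Prop :=
  StiffnessBoxCeilingBelow boxNdSrNiO2E_M22 (4418857 / 10000000)

attribute [conjecture] NdNiO2M21_StiffnessBoxCeiling NdNiO2M22_StiffnessBoxCeiling

/-- `NdNiO2M21_StiffnessBoxCeiling` unfolded. -/
theorem NdNiO2M21_StiffnessBoxCeiling_iff :
    NdNiO2M21_StiffnessBoxCeiling ↔ ∃ c : ℚ, c ≤ 4779578 / 10000000 ∧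
      HoldsOn (fun p : OneBandCoord → ℝ => ObsStiffnessSeqCeilingAt (p .tpOverT) (p .UOverT) (p .filling) c) boxNdNiO2E_M21 :=
  Iff.rfl

/-- `NdNiO2M22_StiffnessBoxCeiling` unfolded. -/
theorem NdNiO2M22_StiffnessBoxCeiling_iff :
    NdNiO2M22_StiffnessBoxCeiling ↔ ∃ c : ℚ, c ≤ 4418857 / 10000000 ∧
      HoldsOn (fun p : OneBandCoord → ℝ => ObsStiffnessSeqCeilingAt (p .tpOverT) (p .UOverT) (p .filling) c) boxNdSrNiO2E_M22 :=
  Iff.rfl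

/-- The bar arithmetic: `0.98 × κ₂₁` rounded down at the 7th decimal is the typed bar, and the bar is strictly below κ₂₁ (the leaf asks for a `2 %`
certified suppression below the kernel kinematic word; it is NOT closed by kinematics). [folklore] -/
theorem ndnio2_M21_bar_arith :
    (4779578 / 10000000 : ℚ) ≤ 98 / 100 * (4877121 / 10000000) ∧ 98 / 100 * (4877121 / 10000000) < (4779579 / 10000000 : ℚ) ∧
      (4779578 / 10000000 : ℚ) < 4877121 / 10000000 := by
  refine ⟨?_, ?_, ?_⟩ <;> norm_num

/-- The twin's bar arithmetic (`0.98 × 0.4509038 ↦ 0.4418857`). [folklore] -/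
theorem ndnio2_M22_bar_arith :
    (4418857 / 10000000 : ℚ) ≤ 98 / 100 * (4509038 / 10000000) ∧ 98 / 100 * (4509038 / 10000000) < (4418858 / 10000000 : ℚ) ∧
      (4418857 / 10000000 : ℚ) < 4509038 / 10000000 := by
  refine ⟨?_, ?_, ?_⟩ <;> norm_num

/-- **NdNiO₂: discharger from a box word** (`HoldsOn … boxNdNiO2E_M21` with `c ≤ 0.4779578`). [cite: ScalapinoWhiteZhang1993, §II] -/
theorem NdNiO2M21_StiffnessBoxCeiling_of_holdsOn {c : ℚ} (hc : c ≤ 4779578 / 10000000)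
    (h : HoldsOn (fun p : OneBandCoord → ℝ => ObsStiffnessSeqCeilingAt (p .tpOverT) (p .UOverT) (p .filling) c) boxNdNiO2E_M21) :
    NdNiO2M21_StiffnessBoxCeiling :=
  stiffnessBoxCeilingBelow_of_holdsOn hc h

/-- **NdNiO₂ at ANY bar: from a CELL leaf** — `c ≤ bar` with `∀ tp ∈ [−23/50, −9/25], ∀ U ∈ [5, 17/2], ∀ n ∈ [213/250, 477/500], ObsStiffnessSeqCeilingAt tp U n c`
gives `StiffnessBoxCeilingBelow boxNdNiO2E_M21 bar` (the shape every 3-D box theorem of `Observables/StiffnessApexTransport{Doped,CurtainDoped,TargetSlot}`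
delivers; bar-parametric so a director bar re-uses it). [cite: ScalapinoWhiteZhang1993, §II] -/
theorem stiffnessBoxCeilingBelow_boxNdNiO2E_M21_of_cellLeaf {bar c : ℚ} (hc : c ≤ bar)
    (hW : ∀ tp ∈ Set.Icc (-23 / 50 : ℝ) (-9 / 25), ∀ U ∈ Set.Icc (5 : ℝ) (17 / 2), ∀ n ∈ Set.Icc (213 / 250 : ℝ) (477 / 500),
      ObsStiffnessSeqCeilingAt tp U n c) :
    StiffnessBoxCeilingBelow boxNdNiO2E_M21 bar := by
  refine stiffnessBoxCeilingBelow_of_holdsOn hc ?_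
  refine holdsOn_of_forall_s2Box (B := boxNdNiO2E_M21) (eU := ndNiO2E_M21_U) (eS := ndNiO2E_M21_tp) (eN := ndNiO2E_M21_n)
    rfl rfl rfl (W := fun θ => ObsStiffnessSeqCeilingAt (θ 1) (θ 0) (θ 2) c) ?_
  rw [ndNiO2E_M21_s2Lo, ndNiO2E_M21_s2Hi]
  intro θ hθ
  obtain ⟨hUθ, htθ, hnθ⟩ := mem_s2Box_vec3 hθ
  exact hW (θ 1) htθ (θ 0) hUθ (θ 2) hnθ

/-- **NdNiO₂: discharger from a CELL leaf** — any `c ≤ 0.4779578` with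
`∀ tp ∈ [−23/50, −9/25], ∀ U ∈ [5, 17/2], ∀ n ∈ [213/250, 477/500], ObsStiffnessSeqCeilingAt tp U n c` closes the leaf. [cite: ScalapinoWhiteZhang1993, §II] -/
theorem NdNiO2M21_StiffnessBoxCeiling_of_cellLeaf {c : ℚ} (hc : c ≤ 4779578 / 10000000)
    (hW : ∀ tp ∈ Set.Icc (-23 / 50 : ℝ) (-9 / 25), ∀ U ∈ Set.Icc (5 : ℝ) (17 / 2), ∀ n ∈ Set.Icc (213 / 250 : ℝ) (477 / 500),
      ObsStiffnessSeqCeilingAt tp U n c) :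
    NdNiO2M21_StiffnessBoxCeiling :=
  stiffnessBoxCeilingBelow_boxNdNiO2E_M21_of_cellLeaf hc hW

/-- **Sr-doped twin at ANY bar: from a CELL leaf** on `[−23/50, −9/25] × [5, 17/2] × [359/500, 409/500]`. [cite: ScalapinoWhiteZhang1993, §II] -/
theorem stiffnessBoxCeilingBelow_boxNdSrNiO2E_M22_of_cellLeaf {bar c : ℚ} (hc : c ≤ bar)
    (hW : ∀ tp ∈ Set.Icc (-23 / 50 : ℝ) (-9 / 25), ∀ U ∈ Set.Icc (5 : ℝ) (17 / 2), ∀ n ∈ Set.Icc (359 / 500 : ℝ) (409 / 500),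
      ObsStiffnessSeqCeilingAt tp U n c) :
    StiffnessBoxCeilingBelow boxNdSrNiO2E_M22 bar := by
  refine stiffnessBoxCeilingBelow_of_holdsOn hc ?_
  refine holdsOn_of_forall_s2Box (B := boxNdSrNiO2E_M22) (eU := ndSrNiO2E_M22_U) (eS := ndSrNiO2E_M22_tp) (eN := ndSrNiO2E_M22_n)
    rfl rfl rfl (W := fun θ => ObsStiffnessSeqCeilingAt (θ 1) (θ 0) (θ 2) c) ?_
  rw [ndSrNiO2E_M22_s2Lo, ndSrNiO2E_M22_s2Hi]
  intro θ hθ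
  obtain ⟨hUθ, htθ, hnθ⟩ := mem_s2Box_vec3 hθ
  exact hW (θ 1) htθ (θ 0) hUθ (θ 2) hnθ

/-- **Sr-doped twin: discharger from a CELL leaf** (`n ∈ [359/500, 409/500]`, bar `0.4418857`). [cite: ScalapinoWhiteZhang1993, §II] -/
theorem NdNiO2M22_StiffnessBoxCeiling_of_cellLeaf {c : ℚ} (hc : c ≤ 4418857 / 10000000)
    (hW : ∀ tp ∈ Set.Icc (-23 / 50 : ℝ) (-9 / 25), ∀ U ∈ Set.Icc (5 : ℝ) (17 / 2), ∀ n ∈ Set.Icc (359 / 500 : ℝ) (409 / 500),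
      ObsStiffnessSeqCeilingAt tp U n c) :
    NdNiO2M22_StiffnessBoxCeiling :=
  stiffnessBoxCeilingBelow_boxNdSrNiO2E_M22_of_cellLeaf hc hW

end Summit.Ventures.CertifiedManyBodySolver.Observables

end
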